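import Literature.Algebra.EuclideanLattices.PQCLLLProofs
import Literature.Algebra.EuclideanLattices.Problems
import Literature.Algebra.EuclideanLattices.UniqueSVPMultiples
import Literature.Algebra.EuclideanLattices.SuccessiveMinimaProofs
import Literature.Algebra.EuclideanLattices.SuccessiveMinimaMinNormPos
import HarnessLib

/-!
# Unique-SVP: a basis vector shorter than `λ₂` is a shortest vector; LLL solves exponential-gap uSVP

Topic `Algebra/EuclideanLattices` (family `pqc`). Proved material (no named fact) towards the
named fact `Literature.Algebra.EuclideanLattices.usvp_of_dihedralCoset` (O. Regev, *Quantum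
computation and lattice problems*, SIAM J. Comput. 33 (2004), Thm. 1.1), namely the
small-dimension branch of Regev's algorithm in the tree's non-asymptotic statement (`∀ n ≥ 2`):
when the uniqueness gap exceeds LLL's approximation factor `2^{(n-1)/2}`, the first vector of an
LLL-reduced basis already is the (unique up to sign) shortest vector, so it can always be put on
the candidate list (Regev, p. 7: "the LLL algorithm gives a `2^{(n-1)/2}`-approximation to the
length of the shortest vector").

* `LatticeInstance.span_real_lattice_eq_top` — a nonsingular integer basis spans `ℝⁿ` over `ℝ`;
* `usvpIsSolution_basis_of_norm_lt_successiveMinimum_two` — a basis vector `bᵢ` of a nonsingular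
  instance (`n ≥ 2`) with `‖bᵢ‖ < λ₂(L(B))` is a shortest nonzero vector: `bᵢ = k ū` for a shortest
  `ū` (`exists_int_smul_of_norm_lt_successiveMinimum_two`) and `bᵢ` is primitive (`det B ≠ 0`
  forces `k uᵢ = 1`);
* `usvpIsSolution_basis_zero_of_lllReduced` — **LLL solves uSVP with gap `> 2^{(n-1)/2}`**: if the
  rows are LLL-reduced (`δ = 3/4`) and `γ(n) λ₁ ≤ λ₂` with `γ(n) > 2^{(n-1)/2}` (`USVP.Promise γ`), then
  `b₀` is a shortest nonzero vector (LLL82 Prop. 1.11, `‖b₀‖² ≤ 2^{n-1} λ₁²`, discharged in the tree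
  as `norm_zero_sq_le_two_pow_mul_minNorm_sq_holds`).

## References

* O. Regev, *Quantum computation and lattice problems*, SIAM J. Comput. 33 (2004), §3.2, p. 7.
* A. K. Lenstra, H. W. Lenstra Jr., L. Lovász, Math. Ann. 261 (1982), Prop. 1.11.
-/

noncomputable section

open Module

namespace Literature.Algebra.EuclideanLattices

namespace LatticeInstance

/-- The rows of a nonsingular integer basis matrix span `ℝⁿ` over `ℝ`, hence so does the lattice
they generate. [Micciancio–Goldwasser 2002, Ch. 1, Def. 1.1] [folklore] -/
theorem span_real_lattice_eq_top {I : LatticeInstance} (hI : I.IsNonsingular) :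
    Submodule.span ℝ (I.lattice : Set (EuclideanSpace ℝ (Fin I.n))) = ⊤ := by
  refine eq_top_iff.2 ?_
  rw [← (basisOfIsNonsingular hI).span_eq, coe_basisOfIsNonsingular]
  refine Submodule.span_mono ?_
  rintro _ ⟨i, rfl⟩
  exact Submodule.subset_span ⟨i, rfl⟩

end LatticeInstance

/-- **A basis vector shorter than `λ₂` is a shortest vector.** For a nonsingular integer basis
`B` of dimension `n ≥ 2`, if `‖bᵢ‖ < λ₂(L(B))` then `bᵢ` is a shortest nonzero vector of `L(B)`:
`bᵢ = k ū` for a shortest nonzero `ū = z ᵥ* B ∈ L(B)` (vectors shorter than `λ₂` are integer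
multiples of the shortest vector), and comparing coefficient vectors (`det B ≠ 0`) gives
`k zᵢ = 1`, so `k = ±1` and `‖bᵢ‖ = ‖ū‖ = λ₁`. [Regev 2004, §3.2 p. 7 (LLL's approximation vs. the
uniqueness gap); Micciancio–Goldwasser 2002, Ch. 1 §1] [folklore] -/
theorem usvpIsSolution_basis_of_norm_lt_successiveMinimum_two {I : LatticeInstance}
    (hI : I.IsNonsingular) (hn : 2 ≤ I.n) (i : Fin I.n)
    (hlt : ‖I.vec i‖ < successiveMinimum I.lattice 2) : USVP.IsSolution I (I.basis i) := by
  have hli : LinearIndependent ℝ I.vec := LatticeInstance.linearIndependent_vec hI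
  have hvi0 : I.vec i ≠ 0 := hli.ne_zero i
  have hvi : I.vec i ∈ I.lattice := Submodule.subset_span ⟨i, rfl⟩
  have hbot : I.lattice ≠ ⊥ := fun h => hvi0 ((Submodule.eq_bot_iff _).1 h _ hvi)
  -- a shortest nonzero vector `ū = z ᵥ* B`
  obtain ⟨u, huL, hu0, hunorm⟩ := exists_mem_norm_eq_minNorm_holds I.lattice hbot
  obtain ⟨z, rfl⟩ := (I.mem_lattice_iff u).1 huL
  -- `bᵢ = k ū` with `k ∈ ℤ`
  have hrank : 2 ≤ finrank ℝ (Submodule.span ℝ (I.lattice : Set (EuclideanSpace ℝ (Fin I.n)))) := by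
    rw [LatticeInstance.span_real_lattice_eq_top hI, finrank_top, finrank_euclideanSpace_fin]
    exact hn
  obtain ⟨k, hk⟩ :=
    exists_int_smul_of_norm_lt_successiveMinimum_two I.lattice hrank huL hu0 hunorm hvi hlt
  -- `k zᵢ = 1`: compare integer coefficient vectors through `det B ≠ 0`
  have hcoef : Matrix.vecMul (Pi.single i 1 - k • z) I.basis = 0 := by
    apply intVecToEuclidean_injective I.n
    rw [Matrix.sub_vecMul, map_sub, Matrix.single_one_vecMul, Matrix.smul_vecMul, map_zsmul,
      map_zero, sub_eq_zero]
    exact hk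
  have hz : Pi.single i 1 - k • z = 0 := Matrix.eq_zero_of_vecMul_eq_zero hI hcoef
  have hki : k * z i = 1 := by
    have := congrFun hz i
    simp only [Pi.sub_apply, Pi.single_eq_same, Pi.smul_apply, smul_eq_mul, Pi.zero_apply,
      sub_eq_zero] at this
    exact this.symm
  have habs : |(k : ℝ)| = 1 := by
    rcases Int.eq_one_or_neg_one_of_mul_eq_one hki with rfl | rfl <;> simp
  refine ⟨fun h0 => hvi0 ?_, hvi, ?_⟩
  · change intVecToEuclidean I.n (I.basis i) = 0
    rw [h0, map_zero]
  · change ‖I.vec i‖ = minNorm I.lattice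
    rw [hk, ← Int.cast_smul_eq_zsmul ℝ k, norm_smul, Real.norm_eq_abs, habs, one_mul, hunorm]

/-- **LLL solves unique-SVP when the gap exceeds `2^{(n-1)/2}`** (the small-dimension branch of
Regev's algorithm). Let `B` be a nonsingular integer basis of dimension `n ≥ 2` whose rows are
LLL-reduced with `δ = 3/4`, and assume the `uSVP` promise `γ(n) λ₁ ≤ λ₂` with
`γ(n) > 2^{(n-1)/2}` (LLL's approximation factor). Then `b₀` is a shortest nonzero vector: by
LLL82 Prop. 1.11, `‖b₀‖² ≤ 2^{n-1} λ₁² < γ(n)² λ₁² ≤ λ₂²` (`λ₁ > 0`), and a basis vector shorter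
than `λ₂` is a shortest vector.
[cite: LenstraLenstraLovasz1982, Prop. 1.11] -/
theorem usvpIsSolution_basis_zero_of_lllReduced {I : LatticeInstance} (hn : 2 ≤ I.n)
    (hred : IsLLLReduced (3 / 4) I.vec) {γ : ℕ → ℝ} (hprom : USVP.Promise γ I)
    (hγ : Real.sqrt 2 ^ (I.n - 1) < γ I.n) :
    USVP.IsSolution I (I.basis ⟨0, by omega⟩) := by
  have hI : I.IsNonsingular := hprom.1
  have hn0 : I.n ≠ 0 := by omega
  refine usvpIsSolution_basis_of_norm_lt_successiveMinimum_two hI hn _ ?_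
  -- LLL82 Prop. 1.11 for the real basis of rows
  have h11 := IsLLLReduced.norm_zero_sq_le_two_pow_mul_minNorm_sq_holds
    (LatticeInstance.basisOfIsNonsingular hI)
    (by rw [LatticeInstance.coe_basisOfIsNonsingular]; exact hred) hn0
  dsimp only [Literature.Computability.Cryptography.latticeOfBasis] at h11
  rw [← LatticeInstance.lattice_eq_span_basisOfIsNonsingular hI,
    LatticeInstance.coe_basisOfIsNonsingular] at h11
  -- `λ₁ > 0`, so `‖b₀‖² < (γ λ₁)² ≤ λ₂²`
  have hli : LinearIndependent ℝ I.vec := LatticeInstance.linearIndependent_vec hI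
  have hv0 : I.vec ⟨0, by omega⟩ ≠ 0 := hli.ne_zero _
  have hv : I.vec ⟨0, by omega⟩ ∈ I.lattice := Submodule.subset_span ⟨_, rfl⟩
  have hbot : I.lattice ≠ ⊥ := fun h => hv0 ((Submodule.eq_bot_iff _).1 h _ hv)
  have hpos : 0 < minNorm I.lattice := minNorm_pos_of_ne_bot I.lattice hbot
  have hs0 : (0 : ℝ) ≤ Real.sqrt 2 ^ (I.n - 1) := by positivity
  have hγpos : 0 < γ I.n := hs0.trans_lt hγ
  have hγsq : (2 : ℝ) ^ (I.n - 1) < γ I.n ^ 2 := by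
    have h := pow_lt_pow_left₀ hγ hs0 two_ne_zero
    rwa [← pow_mul, mul_comm, pow_mul, Real.sq_sqrt (by norm_num : (0 : ℝ) ≤ 2)] at h
  have h2 : ‖I.vec ⟨0, by omega⟩‖ ^ 2 < (γ I.n * minNorm I.lattice) ^ 2 := by
    rw [mul_pow]
    exact h11.trans_lt (mul_lt_mul_of_pos_right hγsq (pow_pos hpos 2))
  have h3 : ‖I.vec ⟨0, by omega⟩‖ < γ I.n * minNorm I.lattice :=
    (pow_lt_pow_iff_left₀ (norm_nonneg _) (by positivity) two_ne_zero).1 h2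
  exact h3.trans_le hprom.2

end Literature.Algebra.EuclideanLattices

end
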